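import Literature.NumberTheory.Sieve.QuadraticRootsPrimeModuliDFIBilinear
import Literature.NumberTheory.Sieve.QuadraticRootsPrimeModuliToth
import HarnessLib

/-!
# Tóth 2000 (positive discriminant), III: hypothesis (35) from a bilinear-form bound `M^{1/2} + N^a M^b` (PROVED)

Topic `Literature/NumberTheory/Sieve`, third companion of the named fact
`Literature.NumberTheory.Sieve.toth2000_quadraticRoots_primeModuli` (`PolynomialCongruencesPrimeModuli.lean`;
Á. Tóth, *Roots of quadratic congruences*, IMRN 2000:14, 719–739).  After
`QuadraticRootsPrimeModuliToth.lean` (reduction to (34)+(35) of DFI's Theorem 5, now a theorem) and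
`QuadraticRootsPrimeModuliTothLinear.lean` ((34) from a linear-form bound of any power-saving shape),
this file treats hypothesis (35) — the general bilinear forms
`R(w, y) = ∑_{w ≤ n < y} β_n ∑_{(m,n)=1, mn ≤ x} α_m ρ_h(mn) ≪ x (log x)^{−10}`, `y = x^{1/3−ε}`,
`w = x^{(log log x)^{−3}}` [cite: DukeFriedlanderIwaniec1995, (33), (35)] — in the same spirit.

In Duke–Friedlander–Iwaniec (negative discriminant) (35) follows from Proposition 2,
`B(M, N) = ∑∑_{(m,n)=1} α_m β_n ρ_h(mn) ≪ ‖αρ‖ ‖β‖ (M^{1/2} + N^{3/4} M^{3/8+ε})`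
[cite: DukeFriedlanderIwaniec1995, Proposition 2 (10)], itself obtained in §5 from the smoothed
linear forms by Cauchy's inequality; the deduction "(35) follows from Proposition 2"
[cite: DukeFriedlanderIwaniec1995, §7 p. 438] is carried out for that shape and `f = aX² + 2bX + c`
in `QuadraticRootsPrimeModuliDFIBilinear{Blocks,Fibres}.lean` / `…DFIBilinear.lean`.  Tóth's
paper follows the same route for positive discriminant with its own (weaker) exponents, coming
from its weaker linear-form estimate (`(N²/x)^{1/(4L)} (x/N)^{1+1/L²}` for all large `L`
[cite: Ngo2024, (1.3)]).  Since only the SHAPE `M^{1/2} + N^a M^b` and one numerical condition on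
`(a, b)` matter for the deduction, this file PROVES it parametrically, for a general `f ∈ ℤ[X]`
with `|ρ_{h'}(n)| ≤ C τ(n)`:

* `DFI1995.hyp35_of_bilinearFormBound` — if `0 ≤ b ≤ a`, `κ := 1/2 − b − (1/3 − ε)(a − b) > 0` and
  `|B(M, N')(α|_{(M,2M]}, β|_S)| ≤ K₂ ‖αρ‖ ‖β‖ (M^{1/2} + N'^a M^b)` for all `M, N' ≥ 1`, fibres
  `S ⊆ (N', 2N']` and `β` supported on primes, then `DFI1995.Hyp35 f h ε`.  (The diagonal term
  `M^{1/2}` gives `x/√w · (log x)^{19}`, killed by `w = x^{(log log x)^{−3}}`; the second term gives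
  `x^{1/2+b} y^{a−b} (log x)^{19} = x^{1−κ} (log x)^{19}`.)  DFI: `(a, b) = (3/4, 3/8 + ε')`,
  `κ = 3ε/8 − ε'(2/3 + ε)`, `= 7ε/24 − ε²/8 > 0` for `ε' = ε/8`;
* `DFI1995.hyp35_of_bilinearFormBound_dfi` — DFI's shape for a general `f` (all `ε' > 0`) ⇒ (35) for
  `0 < ε ≤ 1/12` (the case `f = aX² + 2bX + c`, `ac > b²` being `DFI1995.hyp35_of_proposition2`);
* (in the sequel `QuadraticRootsPrimeModuliTothAssembly.lean`, which joins this file with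
  `…TothLinear.lean`) `toth2000_quadraticRoots_primeModuli_of_linearFormBound_of_bilinearFormBound` —
  Tóth's theorem from the two analytic inputs in parametric shape: a linear-form bound
  `K d^θ M^{1−θ+η}` with `η < 2εθ` and a bilinear-form bound `M^{1/2} + N^a M^b` with `κ > 0`, for
  every irreducible quadratic of positive discriminant, every `h ≥ 1` and every `0 < ε ≤ 1/12`.

The supporting lemmas are the parametric versions of `DFI1995.norm_fiberSum_le`,
`DFI1995.fiber_term2_le`, `DFI1995.norm_fiberSum_fiber_le`, `DFI1995.norm_sieveR₂_rho_le`,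
`DFI1995.hyp35_final_bound` (same proofs, exponents `(3/4, 3/8 + ε')` replaced by `(a, b)`).  No new
named fact is introduced; Tóth's bilinear estimate enters only as a HYPOTHESIS of parametric
shape (the paper [Toth2000] is not held; its exact exponents are to be read off the paper when it
is acquired — what is needed is, for each `0 < ε ≤ 1/12`, one admissible pair `(a, b)`, i.e. one
with `κ = 1/2 − b − (1/3 − ε)(a − b) > 0`; a saving `(N³/x)^{σ} M^{η}` relative to the trivial
bound, i.e. `a = 1/2 + 2σ`, `b = 1/2 − σ + η`, is admissible as soon as `η < 3εσ`).

## References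

* Á. Tóth, *Roots of quadratic congruences*, Internat. Math. Res. Notices 2000, no. 14, 719–739.
  [cite: Toth2000, main theorem]
* W. Duke, J. B. Friedlander, H. Iwaniec, *Equidistribution of roots of a quadratic congruence to
  prime moduli*, Ann. of Math. (2) 141 (1995), 423–441: Proposition 2 (10), (33), (35), Theorem 5
  (p. 437), §5, §7 (p. 438). [cite: DukeFriedlanderIwaniec1995, Proposition 2 and §7]
* H. T. Ngo, *On roots of quadratic congruences*, Bull. Lond. Math. Soc. 56 (2024) 2886–2910, §1
  (1.3). [cite: Ngo2024, §1 (1.3)]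
-/

namespace Literature.NumberTheory.Sieve

open scoped BigOperators Polynomial
open Filter Asymptotics Finset Polynomial

namespace DFI1995

/-! ### One fibre: dyadic blocks in `m`, shape `M^{1/2} + N'^a M^b` -/

/-- **The main term of one fibre, shape `M^{1/2} + N'^a M^b`**: `|T_S(X)| ≤ (2 log x + 1) · K₂ ·
2C log x (X(1+log x)³)^{1/2} · (#S)^{1/2} · ((X/2)^{1/2} + N'^a (X/2)^b)` — dyadic blocks, each
bounded by the bilinear hypothesis (blocks below `1` vanish), at most `log₂ x + 1` of them; the
argument of `DFI1995.norm_fiberSum_le` (the case `a = 3/4`, `b = 3/8 + ε'`). [folklore] -/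
theorem norm_fiberSum_le_of_exponents {f : ℤ[X]} {h : ℤ} {C K₂ a b N' X x : ℝ} {α β : ℕ → ℂ}
    {S : Finset ℕ} (hC : 0 ≤ C) (hK₂ : 0 ≤ K₂) (hb : 0 ≤ b)
    (hρ0 : ∀ n : ℕ, 1 ≤ n → ‖polyRootWeylSum f n 0‖ ≤ C * (Nat.divisors n).card)
    (hα : ∀ m : ℕ, ‖α m‖ ≤ ArithmeticFunction.cardDistinctFactors m) (hβ : ∀ n : ℕ, ‖β n‖ ≤ 1)
    (hS : S ⊆ Icc 1 ⌊2 * N'⌋₊)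
    (hblock : ∀ M : ℝ, 1 ≤ M →
      ‖bilinearForm f h (blockAlpha α M) (fiberBeta β S) M N'‖ ≤
        K₂ * normAlphaRho f (blockAlpha α M) M * l2Norm (fiberBeta β S) N' *
          (M ^ (1 / 2 : ℝ) + N' ^ a * M ^ b))
    (hN' : 0 ≤ N') (hX0 : 0 ≤ X) (hXx : X ≤ x) (hx : 1 ≤ x) :
    ‖fiberSum f h α β S X‖ ≤
      (2 * Real.log x + 1) * (K₂ * (2 * C * Real.log x * Real.sqrt (X * (1 + Real.log x) ^ 3)) *
        Real.sqrt S.card * ((X / 2) ^ (1 / 2 : ℝ) + N' ^ a * (X / 2) ^ b)) := by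
  set J : ℕ := Nat.log 2 ⌊X⌋₊ + 1 with hJ
  have hlx : 0 ≤ Real.log x := Real.log_nonneg hx
  -- the leftover vanishes
  have hleft : fiberSum f h α β S (X / 2 ^ J) = 0 := by
    refine fiberSum_eq_zero_of_lt_one f h α β S ?_
    rw [div_lt_one (by positivity)]
    have h1 : ⌊X⌋₊ < 2 ^ J := by
      rw [hJ]; exact Nat.lt_pow_succ_log_self one_lt_two _
    calc X < (⌊X⌋₊ : ℝ) + 1 := Nat.lt_floor_add_one X
      _ ≤ ((2 ^ J : ℕ) : ℝ) := by exact_mod_cast h1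
      _ = 2 ^ J := by push_cast; ring
  -- the number of blocks
  have hJle : (J : ℝ) ≤ 2 * Real.log x + 1 := by
    rw [hJ]; push_cast
    rcases lt_or_ge X 1 with hX1 | hX1
    · have : ⌊X⌋₊ = 0 := Nat.floor_eq_zero.2 hX1
      rw [this, Nat.log_zero_right]; push_cast; linarith
    · have h1 := natLog_two_floor_le hX1
      have h2 : Real.log X ≤ Real.log x := Real.log_le_log (by linarith) hXx
      linarith
  -- each block
  set G : ℝ := K₂ * (2 * C * Real.log x * Real.sqrt (X * (1 + Real.log x) ^ 3)) *
    Real.sqrt S.card * ((X / 2) ^ (1 / 2 : ℝ) + N' ^ a * (X / 2) ^ b) with hG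
  have hG0 : 0 ≤ G := by rw [hG]; positivity
  have hblockj : ∀ j ∈ Finset.range J,
      ‖fiberSum f h α β S (2 * (X / 2 ^ (j + 1))) - fiberSum f h α β S (X / 2 ^ (j + 1))‖ ≤ G := by
    intro j _
    set M : ℝ := X / 2 ^ (j + 1) with hM
    have hM0 : 0 ≤ M := by positivity
    have hMX : M ≤ X / 2 :=
      div_le_div_of_nonneg_left hX0 (by norm_num) (by
        calc (2 : ℝ) = 2 ^ (0 + 1) := by norm_num
          _ ≤ 2 ^ (j + 1) := pow_le_pow_right₀ (by norm_num) (by omega))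
    have h2MX : 2 * M ≤ X := by linarith
    rw [fiberSum_two_mul_sub f h α β hS hM0]
    rcases lt_or_ge M 1 with hM1 | hM1
    · rw [bilinearForm_blockAlpha_eq_zero_of_lt_one f h hα _ hM0 hM1, norm_zero]
      exact hG0
    · have hnAR : normAlphaRho f (blockAlpha α M) M ≤
          2 * C * Real.log x * Real.sqrt (X * (1 + Real.log x) ^ 3) := by
        refine (normAlphaRho_blockAlpha_le hC hρ0 hα hM0 (h2MX.trans hXx) hx).trans ?_
        refine mul_le_mul_of_nonneg_left (Real.sqrt_le_sqrt ?_) (by positivity)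
        have : 0 ≤ (1 + Real.log x) ^ 3 := by positivity
        nlinarith
      have hl2 := l2Norm_fiberBeta_le hβ S N'
      have hP : M ^ (1 / 2 : ℝ) + N' ^ a * M ^ b ≤
          (X / 2) ^ (1 / 2 : ℝ) + N' ^ a * (X / 2) ^ b := by
        have h1 : M ^ (1 / 2 : ℝ) ≤ (X / 2) ^ (1 / 2 : ℝ) := Real.rpow_le_rpow hM0 hMX (by norm_num)
        have h2 : M ^ b ≤ (X / 2) ^ b := Real.rpow_le_rpow hM0 hMX hb
        have h3 : (0 : ℝ) ≤ N' ^ a := Real.rpow_nonneg hN' _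
        nlinarith [mul_le_mul_of_nonneg_left h2 h3]
      have hl20 : 0 ≤ l2Norm (fiberBeta β S) N' := by unfold l2Norm; positivity
      have hnAR0 : 0 ≤ normAlphaRho f (blockAlpha α M) M := by unfold normAlphaRho; positivity
      have hP0 : 0 ≤ M ^ (1 / 2 : ℝ) + N' ^ a * M ^ b := by positivity
      calc ‖bilinearForm f h (blockAlpha α M) (fiberBeta β S) M N'‖
          ≤ K₂ * normAlphaRho f (blockAlpha α M) M * l2Norm (fiberBeta β S) N' *
              (M ^ (1 / 2 : ℝ) + N' ^ a * M ^ b) := hblock M hM1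
        _ ≤ G := by
          rw [hG]
          apply mul_le_mul _ hP hP0 (by positivity)
          exact mul_le_mul (mul_le_mul_of_nonneg_left hnAR hK₂) hl2 hl20 (by positivity)
  -- assemble
  rw [fiberSum_eq_dyadic f h α β S X J, hleft, zero_add]
  calc ‖∑ j ∈ Finset.range J, (fiberSum f h α β S (2 * (X / 2 ^ (j + 1))) -
        fiberSum f h α β S (X / 2 ^ (j + 1)))‖
      ≤ ∑ j ∈ Finset.range J, ‖fiberSum f h α β S (2 * (X / 2 ^ (j + 1))) -
        fiberSum f h α β S (X / 2 ^ (j + 1))‖ := norm_sum_le _ _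
    _ ≤ ∑ j ∈ Finset.range J, G := Finset.sum_le_sum hblockj
    _ = J * G := by rw [Finset.sum_const, Finset.card_range, nsmul_eq_mul]
    _ ≤ (2 * Real.log x + 1) * G := mul_le_mul_of_nonneg_right hJle hG0

/-- Second term of a fibre, general exponents: `√X √s N'^a (X/2)^b ≤ √3 x^{1/2+b} y^{a−b}` for
`X = x/(2N')`, `s ≤ 3N'`, `1 ≤ N' ≤ y`, `0 ≤ b ≤ a` (the case `a = 3/4`, `b = 3/8 + ε'` is
`DFI1995.fiber_term2_le`, up to `y^{3/8−ε'} ≤ y^{3/8}`). [folklore] -/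
theorem fiber_term2_le_of_exponents {x N' y s a b : ℝ} (hx : 0 < x) (hN' : 1 ≤ N') (hN'y : N' ≤ y)
    (hs : s ≤ 3 * N') (hb0 : 0 ≤ b) (hab : b ≤ a) :
    Real.sqrt (x / (2 * N')) * Real.sqrt s * (N' ^ a * (x / (2 * N') / 2) ^ b) ≤
      Real.sqrt 3 * x ^ (1 / 2 + b) * y ^ (a - b) := by
  have hN'0 : 0 < N' := by linarith
  set X : ℝ := x / (2 * N') with hX
  have hX0 : 0 < X := by positivity
  -- `√X (X/2)^b ≤ X^{1/2+b}`
  have h1 : Real.sqrt X * (X / 2) ^ b ≤ X ^ (1 / 2 + b) := by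
    rw [Real.sqrt_eq_rpow]
    calc X ^ (1 / 2 : ℝ) * (X / 2) ^ b ≤ X ^ (1 / 2 : ℝ) * X ^ b :=
          mul_le_mul_of_nonneg_left (Real.rpow_le_rpow (by positivity) (by linarith) hb0)
            (by positivity)
      _ = X ^ (1 / 2 + b) := by rw [← Real.rpow_add hX0]
  -- `√s N'^a ≤ √3 N'^{1/2+a}`
  have h2 : Real.sqrt s * N' ^ a ≤ Real.sqrt 3 * N' ^ (1 / 2 + a) := by
    have : Real.sqrt s ≤ Real.sqrt 3 * N' ^ (1 / 2 : ℝ) := by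
      rw [← Real.sqrt_eq_rpow, ← Real.sqrt_mul (by norm_num)]
      exact Real.sqrt_le_sqrt hs
    calc Real.sqrt s * N' ^ a ≤ Real.sqrt 3 * N' ^ (1 / 2 : ℝ) * N' ^ a :=
          mul_le_mul_of_nonneg_right this (Real.rpow_nonneg hN'0.le _)
      _ = Real.sqrt 3 * N' ^ (1 / 2 + a) := by
          rw [mul_assoc, ← Real.rpow_add hN'0]
  -- `X^{1/2+b} N'^{1/2+a} ≤ x^{1/2+b} N'^{a−b}`
  have h3 : X ^ (1 / 2 + b) * N' ^ (1 / 2 + a) ≤ x ^ (1 / 2 + b) * N' ^ (a - b) := by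
    have hXle : X ≤ x / N' := by
      rw [hX]; exact div_le_div_of_nonneg_left hx.le hN'0 (by linarith)
    have he : 0 ≤ 1 / 2 + b := by linarith
    calc X ^ (1 / 2 + b) * N' ^ (1 / 2 + a) ≤ (x / N') ^ (1 / 2 + b) * N' ^ (1 / 2 + a) :=
          mul_le_mul_of_nonneg_right (Real.rpow_le_rpow hX0.le hXle he) (Real.rpow_nonneg hN'0.le _)
      _ = x ^ (1 / 2 + b) * (N' ^ (1 / 2 + a) / N' ^ (1 / 2 + b)) := by
          rw [Real.div_rpow hx.le hN'0.le]; ring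
      _ = x ^ (1 / 2 + b) * N' ^ (a - b) := by
          rw [← Real.rpow_sub hN'0, show (1 / 2 + a - (1 / 2 + b) : ℝ) = a - b by ring]
  have h4 : N' ^ (a - b) ≤ y ^ (a - b) := Real.rpow_le_rpow hN'0.le hN'y (by linarith)
  calc Real.sqrt X * Real.sqrt s * (N' ^ a * (X / 2) ^ b)
      = (Real.sqrt X * (X / 2) ^ b) * (Real.sqrt s * N' ^ a) := by ring
    _ ≤ X ^ (1 / 2 + b) * (Real.sqrt 3 * N' ^ (1 / 2 + a)) :=
        mul_le_mul h1 h2 (by positivity) (by positivity)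
    _ = Real.sqrt 3 * (X ^ (1 / 2 + b) * N' ^ (1 / 2 + a)) := by ring
    _ ≤ Real.sqrt 3 * (x ^ (1 / 2 + b) * N' ^ (a - b)) :=
        mul_le_mul_of_nonneg_left h3 (Real.sqrt_nonneg _)
    _ ≤ Real.sqrt 3 * (x ^ (1 / 2 + b) * y ^ (a - b)) :=
        mul_le_mul_of_nonneg_left (mul_le_mul_of_nonneg_left h4 (by positivity)) (Real.sqrt_nonneg _)
    _ = Real.sqrt 3 * x ^ (1 / 2 + b) * y ^ (a - b) := by ring

/-- **The main term of one fibre, in final form, shape `M^{1/2} + N'^a M^b`**: for a fibre `S` of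
integers in `[N_k, N_{k+1})`, `N_{k+1} = (1+Δ)N_k ≥ w ≥ 2`, meeting `[1, y)`, and the cutoff
`X = x/N_{k+1}`, `|T_S(X)| ≤ (2 log x + 1) K₂ 2C log x √(L³) (√2 x/√w + √3 x^{1/2+b} y^{a−b})`
(`0 ≤ b ≤ a`; the argument of `DFI1995.norm_fiberSum_fiber_le`). [folklore] -/
theorem norm_fiberSum_fiber_le_of_exponents {f : ℤ[X]} {h : ℤ} {C K₂ a b x w y Δ Nk Nk1 : ℝ}
    {α β : ℕ → ℂ} {S : Finset ℕ} (hC : 0 ≤ C) (hK₂ : 0 ≤ K₂) (hb0 : 0 ≤ b) (hab : b ≤ a)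
    (hρ0 : ∀ n : ℕ, 1 ≤ n → ‖polyRootWeylSum f n 0‖ ≤ C * (Nat.divisors n).card)
    (hα : ∀ m : ℕ, ‖α m‖ ≤ ArithmeticFunction.cardDistinctFactors m) (hβ : ∀ n : ℕ, ‖β n‖ ≤ 1)
    (hK₂N' : ∀ M : ℝ, 1 ≤ M → ∀ S' : Finset ℕ,
      (∀ n ∈ S', Nk1 / 2 < (n : ℝ) ∧ (n : ℝ) ≤ 2 * (Nk1 / 2)) →
      ‖bilinearForm f h (blockAlpha α M) (fiberBeta β S') M (Nk1 / 2)‖ ≤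
        K₂ * normAlphaRho f (blockAlpha α M) M * l2Norm (fiberBeta β S') (Nk1 / 2) *
          (M ^ (1 / 2 : ℝ) + (Nk1 / 2) ^ a * M ^ b))
    (hx1 : 1 ≤ x) (hw : 2 ≤ w) (hy0 : 0 ≤ y) (hΔ0 : 0 < Δ) (hΔ : Δ ≤ 1 / 2) (hwNk : w ≤ Nk)
    (hNk1 : Nk1 = (1 + Δ) * Nk)
    (hS : ∀ n ∈ S, 1 ≤ n ∧ (n : ℝ) < y ∧ Nk ≤ (n : ℝ) ∧ (n : ℝ) < Nk1) :
    ‖fiberSum f h α β S (x / Nk1)‖ ≤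
      (2 * Real.log x + 1) * (K₂ * (2 * C * Real.log x) * Real.sqrt ((1 + Real.log x) ^ 3)) *
        (Real.sqrt 2 * x / Real.sqrt w + Real.sqrt 3 * x ^ (1 / 2 + b) * y ^ (a - b)) := by
  have hx0 : 0 < x := by linarith
  have hw0 : 0 < w := by linarith
  have hNk0 : 0 < Nk := by linarith
  have hNk10 : 0 < Nk1 := by rw [hNk1]; positivity
  have hlx0 : 0 ≤ Real.log x := Real.log_nonneg hx1
  rcases S.eq_empty_or_nonempty with hSe | hne
  · rw [hSe]; unfold fiberSum
    simp only [Finset.sum_empty, norm_zero]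
    have hy : 0 ≤ y ^ (a - b) := Real.rpow_nonneg hy0 _
    positivity
  · obtain ⟨n₀, hn₀⟩ := hne
    obtain ⟨-, hn₀y, hNn₀, -⟩ := hS n₀ hn₀
    set N' : ℝ := Nk1 / 2 with hN'
    have hN'1 : 1 ≤ N' := by rw [hN', hNk1]; nlinarith
    have hN'0 : 0 < N' := by linarith
    have hXk : x / Nk1 = x / (2 * N') := by rw [hN']; congr 1; ring
    have hN'y : N' ≤ y := by
      have h2 : Nk < y := lt_of_le_of_lt hNn₀ hn₀y
      rw [hN', hNk1]; nlinarith
    have hSsub : S ⊆ Icc 1 ⌊2 * N'⌋₊ := fun n hn => by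
      obtain ⟨hn1, -, -, hnN⟩ := hS n hn
      refine Finset.mem_Icc.2 ⟨hn1, Nat.le_floor ?_⟩
      rw [hN']; linarith
    have hSbd : ∀ n ∈ S, N' < (n : ℝ) ∧ (n : ℝ) ≤ 2 * N' := fun n hn => by
      obtain ⟨-, -, hNn, hnN⟩ := hS n hn
      constructor
      · rw [hN', hNk1]; nlinarith
      · rw [hN']; linarith
    have hblock := fun M (hM : (1 : ℝ) ≤ M) => hK₂N' M hM S hSbd
    have hXk0 : 0 ≤ x / Nk1 := by positivity
    have hXkx : x / Nk1 ≤ x := div_le_self hx0.le (by linarith)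
    have hfib := norm_fiberSum_le_of_exponents hC hK₂ hb0 hρ0 hα hβ hSsub hblock hN'0.le hXk0 hXkx hx1
    have hs : (S.card : ℝ) ≤ 2 * N' * Δ + 1 := by
      have h1 := card_le_of_bounds ⟨n₀, hn₀⟩ (fun n hn => ⟨(hS n hn).2.2.1, (hS n hn).2.2.2.le⟩)
      have h2 : Nk1 - Nk = Δ * Nk := by rw [hNk1]; ring
      have h3 : Nk ≤ 2 * N' := by rw [hN', hNk1]; nlinarith
      have h4 : Δ * Nk ≤ Δ * (2 * N') := mul_le_mul_of_nonneg_left h3 hΔ0.le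
      linarith
    have hs3 : (S.card : ℝ) ≤ 3 * N' := by
      have : 2 * N' * Δ ≤ N' := by nlinarith
      linarith
    have ht1 := fiber_term1_le (s := (S.card : ℝ)) hx0.le hN'1 hΔ hs
    have ht2 := fiber_term2_le_of_exponents (s := (S.card : ℝ)) hx0 hN'1 hN'y hs3 hb0 hab
    have hN'w : x / Real.sqrt N' ≤ Real.sqrt 2 * x / Real.sqrt w := by
      have h1 : w / 2 ≤ N' := by rw [hN', hNk1]; nlinarith
      have h2 : Real.sqrt (w / 2) ≤ Real.sqrt N' := Real.sqrt_le_sqrt h1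
      have h3 : Real.sqrt (w / 2) = Real.sqrt w / Real.sqrt 2 := Real.sqrt_div hw0.le 2
      have hsw : 0 < Real.sqrt w := Real.sqrt_pos.2 hw0
      have hs2 : 0 < Real.sqrt 2 := by positivity
      have hw2pos : 0 < Real.sqrt (w / 2) := by rw [h3]; positivity
      calc x / Real.sqrt N' ≤ x / Real.sqrt (w / 2) := div_le_div_of_nonneg_left hx0.le hw2pos h2
        _ = Real.sqrt 2 * x / Real.sqrt w := by rw [h3]; field_simp
    rw [hXk] at hfib ⊢
    refine hfib.trans ?_
    have hsqrt : Real.sqrt (x / (2 * N') * (1 + Real.log x) ^ 3) =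
        Real.sqrt (x / (2 * N')) * Real.sqrt ((1 + Real.log x) ^ 3) :=
      Real.sqrt_mul (by positivity) _
    rw [hsqrt]
    have hcore : Real.sqrt (x / (2 * N')) * Real.sqrt (S.card) *
        ((x / (2 * N') / 2) ^ (1 / 2 : ℝ) + N' ^ a * (x / (2 * N') / 2) ^ b) ≤
        Real.sqrt 2 * x / Real.sqrt w + Real.sqrt 3 * x ^ (1 / 2 + b) * y ^ (a - b) := by
      rw [mul_add]
      exact add_le_add (ht1.trans hN'w) ht2
    have hpre : 0 ≤ (2 * Real.log x + 1) *
        (K₂ * (2 * C * Real.log x) * Real.sqrt ((1 + Real.log x) ^ 3)) := by positivity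
    calc (2 * Real.log x + 1) * (K₂ * (2 * C * Real.log x *
          (Real.sqrt (x / (2 * N')) * Real.sqrt ((1 + Real.log x) ^ 3))) * Real.sqrt (S.card) *
          ((x / (2 * N') / 2) ^ (1 / 2 : ℝ) + N' ^ a * (x / (2 * N') / 2) ^ b))
        = (2 * Real.log x + 1) * (K₂ * (2 * C * Real.log x) * Real.sqrt ((1 + Real.log x) ^ 3)) *
            (Real.sqrt (x / (2 * N')) * Real.sqrt (S.card) *
              ((x / (2 * N') / 2) ^ (1 / 2 : ℝ) + N' ^ a * (x / (2 * N') / 2) ^ b)) := by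
          ring
      _ ≤ _ := mul_le_mul_of_nonneg_left hcore hpre

/-- **`R(w, y)` for `ρ_h` at a given `x`, shape `M^{1/2} + N'^a M^b`**: with `L = 1 + log x`,
`Δ = L^{−14}`, `N_k = w (1+Δ)^k`, `K = ⌈log(y/w)/log(1+Δ)⌉`, the fibres `N_k ≤ n < N_{k+1}` give
`|R(w,y)| ≤ 8C log x (L(ΔxL + y) + y√x) + K · (2 log x + 1) K₂ 2C log x √(L³) (√2 x/√w + √3 x^{1/2+b} y^{a−b})`
(cutoff replacement + the bilinear hypothesis on the dyadic blocks; the argument of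
`DFI1995.norm_sieveR₂_rho_le`, which is the case `a = 3/4`, `b = 3/8 + ε'`). [folklore] -/
theorem norm_sieveR₂_rho_le_of_exponents {f : ℤ[X]} {h : ℤ} {C K₂ a b x w y : ℝ} {α β : ℕ → ℂ}
    (hC : 0 ≤ C) (hK₂ : 0 ≤ K₂) (hb0 : 0 ≤ b) (hab : b ≤ a)
    (hρ : ∀ h' : ℤ, ∀ n : ℕ, 1 ≤ n → ‖polyRootWeylSum f n h'‖ ≤ C * (Nat.divisors n).card)
    (hK₂all : ∀ M N' : ℝ, 1 ≤ M → 1 ≤ N' → ∀ (α β : ℕ → ℂ) (S : Finset ℕ),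
      (∀ n ∈ S, N' < (n : ℝ) ∧ (n : ℝ) ≤ 2 * N') → (∀ n : ℕ, ¬ n.Prime → β n = 0) →
      ‖bilinearForm f h (blockAlpha α M) (fiberBeta β S) M N'‖ ≤
        K₂ * normAlphaRho f (blockAlpha α M) M * l2Norm (fiberBeta β S) N' *
          (M ^ (1 / 2 : ℝ) + N' ^ a * M ^ b))
    (hα : ∀ m : ℕ, ‖α m‖ ≤ ArithmeticFunction.cardDistinctFactors m) (hβ : ∀ n : ℕ, ‖β n‖ ≤ 1)
    (hβp : ∀ n : ℕ, ¬ n.Prime → β n = 0)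
    (hx : Real.exp 1 ≤ x) (hw : 2 ≤ w) (hy0 : 0 ≤ y) (hyx : y ≤ x) :
    ‖sieveR₂ (rhoSeq f h) α β x w y‖ ≤
      8 * C * Real.log x * ((1 + Real.log x) * ((1 + Real.log x)⁻¹ ^ 14 * x * (1 + Real.log x) + y) +
          y * Real.sqrt x) +
        (⌈Real.log (y / w) / Real.log (1 + (1 + Real.log x)⁻¹ ^ 14)⌉₊ : ℝ) *
          ((2 * Real.log x + 1) * (K₂ * (2 * C * Real.log x) * Real.sqrt ((1 + Real.log x) ^ 3)) *
            (Real.sqrt 2 * x / Real.sqrt w + Real.sqrt 3 * x ^ (1 / 2 + b) * y ^ (a - b))) := by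
  -- basic facts about `x`
  have hx1 : (1 : ℝ) ≤ x := le_trans (by have := Real.add_one_le_exp (1 : ℝ); linarith) hx
  have hx0 : (0 : ℝ) < x := by linarith
  have hlogx : 1 ≤ Real.log x := by
    rw [← Real.log_exp 1]; exact Real.log_le_log (Real.exp_pos 1) hx
  set L : ℝ := 1 + Real.log x with hL
  have hL2 : 2 ≤ L := by linarith
  have hL0 : 0 < L := by linarith
  set Δ : ℝ := L⁻¹ ^ 14 with hΔdef
  have hΔ0 : 0 < Δ := by positivity
  have hΔ : Δ ≤ 1 / 2 := by
    rw [hΔdef, inv_pow]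
    have : (2 : ℝ) ^ 14 ≤ L ^ 14 := pow_le_pow_left₀ (by norm_num) hL2 14
    calc (L ^ 14)⁻¹ ≤ ((2 : ℝ) ^ 14)⁻¹ := by
          apply inv_anti₀ (by positivity) this
      _ ≤ 1 / 2 := by norm_num
  have hw0 : 0 < w := by linarith
  set N : ℕ → ℝ := fun k => w * (1 + Δ) ^ k with hNdef
  have hN0 : ∀ k, 0 < N k := fun k => by positivity
  have hNsucc : ∀ k, N (k + 1) = (1 + Δ) * N k := fun k => by
    simp only [hNdef, pow_succ]; ring
  have hNmono : ∀ k₁ k₂, k₁ ≤ k₂ → N k₁ ≤ N k₂ := fun k₁ k₂ hk => by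
    simp only [hNdef]
    exact mul_le_mul_of_nonneg_left (pow_le_pow_right₀ (by linarith) hk) hw0.le
  have hNge : ∀ k, w ≤ N k := fun k => by
    have := hNmono 0 k (Nat.zero_le _); simpa [hNdef] using this
  set Kmax : ℕ := ⌈Real.log (y / w) / Real.log (1 + Δ)⌉₊ with hKmax
  have hlog1Δ : 0 < Real.log (1 + Δ) := Real.log_pos (by linarith)
  -- `N_{Kmax} ≥ y` as soon as `y > w`
  have hNK : w < y → y ≤ N Kmax := by
    intro hyw
    have hy0 : 0 < y := hw0.trans hyw
    have ht0 : 0 ≤ Real.log (y / w) / Real.log (1 + Δ) :=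
      div_nonneg (Real.log_nonneg ((one_le_div hw0).2 hyw.le)) hlog1Δ.le
    have h1 : (1 + Δ) ^ (Real.log (y / w) / Real.log (1 + Δ)) = y / w := by
      rw [Real.rpow_def_of_pos (by linarith), mul_div_cancel₀ _ hlog1Δ.ne', Real.exp_log (by positivity)]
    have h2 : y / w ≤ (1 + Δ) ^ Kmax := by
      rw [← h1, ← Real.rpow_natCast]
      exact Real.rpow_le_rpow_of_exponent_le (by linarith) (Nat.le_ceil _)
    calc y = w * (y / w) := by field_simp
      _ ≤ w * (1 + Δ) ^ Kmax := mul_le_mul_of_nonneg_left h2 hw0.le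
  -- the fibres
  set F₂ : Finset ℕ := (Icc 1 ⌊x⌋₊).filter (fun n : ℕ => w ≤ (n : ℝ) ∧ (n : ℝ) < y) with hF₂
  set S : ℕ → Finset ℕ := fun k => F₂.filter (fun n : ℕ => N k ≤ (n : ℝ) ∧ (n : ℝ) < N (k + 1))
    with hSdef
  have hF₂mem : ∀ n ∈ F₂, 1 ≤ n ∧ (n : ℝ) ≤ x ∧ w ≤ (n : ℝ) ∧ (n : ℝ) < y := fun n hn => by
    rw [hF₂, Finset.mem_filter, Finset.mem_Icc] at hn
    exact ⟨hn.1.1, le_trans (by exact_mod_cast hn.1.2) (Nat.floor_le hx0.le), hn.2.1, hn.2.2⟩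
  have hSmem : ∀ k, ∀ n ∈ S k, (1 ≤ n ∧ (n : ℝ) ≤ x ∧ w ≤ (n : ℝ) ∧ (n : ℝ) < y) ∧
      N k ≤ (n : ℝ) ∧ (n : ℝ) < N (k + 1) := fun k n hn => by
    rw [hSdef, Finset.mem_filter] at hn
    exact ⟨hF₂mem n hn.1, hn.2.1, hn.2.2⟩
  have hcover : F₂ = (Finset.range Kmax).biUnion S := by
    ext n
    constructor
    · intro hn
      obtain ⟨-, -, hwn, hny⟩ := hF₂mem n hn
      have hyw : w < y := lt_of_le_of_lt hwn hny
      have hNK' := hNK hyw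
      have hK1 : 1 ≤ Kmax := by
        rw [hKmax]
        refine Nat.one_le_iff_ne_zero.2 (fun h0 => ?_)
        have := Nat.ceil_eq_zero.1 h0
        have hpos : 0 < Real.log (y / w) / Real.log (1 + Δ) :=
          div_pos (Real.log_pos ((one_lt_div hw0).2 hyw)) hlog1Δ
        linarith
      have hex : ∃ k : ℕ, (n : ℝ) < N (k + 1) :=
        ⟨Kmax - 1, by rw [Nat.sub_add_cancel hK1]; linarith⟩
      classical
      set k₀ := Nat.find hex with hk₀def
      have hk₀ : (n : ℝ) < N (k₀ + 1) := Nat.find_spec hex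
      have hlow : N k₀ ≤ n := by
        rcases Nat.eq_zero_or_pos k₀ with h0 | hpos
        · rw [h0]; simpa [hNdef] using hwn
        · have hm : ¬ (n : ℝ) < N (k₀ - 1 + 1) := Nat.find_min hex (by omega)
          rw [Nat.sub_add_cancel hpos] at hm
          exact not_lt.1 hm
      have hk₀K : k₀ < Kmax := by
        have : k₀ ≤ Kmax - 1 := Nat.find_min' hex (by rw [Nat.sub_add_cancel hK1]; linarith)
        omega
      exact Finset.mem_biUnion.2 ⟨k₀, Finset.mem_range.2 hk₀K,
        Finset.mem_filter.2 ⟨hn, hlow, hk₀⟩⟩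
    · intro hn
      obtain ⟨k, -, hk⟩ := Finset.mem_biUnion.1 hn
      exact (Finset.mem_filter.1 hk).1
  have hdisj : Set.PairwiseDisjoint (↑(Finset.range Kmax) : Set ℕ) S := by
    intro k₁ _ k₂ _ hne
    rw [Function.onFun, Finset.disjoint_left]
    intro n h1 h2
    obtain ⟨-, ha1, hb1⟩ := hSmem k₁ n h1
    obtain ⟨-, ha2, hb2⟩ := hSmem k₂ n h2
    rcases lt_or_gt_of_ne hne with hlt | hlt
    · have := hNmono (k₁ + 1) k₂ hlt; linarith
    · have := hNmono (k₂ + 1) k₁ hlt; linarith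
  -- Step 1: split `R(w, y)` over the fibres
  have hR : sieveR₂ (rhoSeq f h) α β x w y = ∑ k ∈ Finset.range Kmax, ∑ n ∈ S k,
      β n * ∑ m ∈ (Icc 1 (⌊x⌋₊ / n)).filter (fun m : ℕ => Nat.Coprime m n),
        α m * polyRootWeylSum f (m * n) h := by
    unfold sieveR₂
    rw [← Finset.sum_biUnion hdisj, ← hcover]
    rfl
  -- Step 2: per fibre, error + main
  set X : ℕ → ℝ := fun k => x / N (k + 1) with hXdef
  set errTerm : ℕ → ℝ := fun n => 8 * C * Real.log x * ((Δ * x / n + 1) * (1 + Real.log x) + Real.sqrt x)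
    with herr
  set MainFib : ℝ := (2 * Real.log x + 1) * (K₂ * (2 * C * Real.log x) * Real.sqrt (L ^ 3)) *
    (Real.sqrt 2 * x / Real.sqrt w + Real.sqrt 3 * x ^ (1 / 2 + b) * y ^ (a - b)) with hMainFib
  have hlx0 : 0 ≤ Real.log x := by linarith
  have hMainFib0 : 0 ≤ MainFib := by
    rw [hMainFib]
    have : 0 ≤ y ^ (a - b) := Real.rpow_nonneg hy0 _
    positivity
  -- Step 3: the cutoff error on each fibre, and its sum
  have herrk : ∀ k ∈ Finset.range Kmax,
      ‖(∑ n ∈ S k, β n * ∑ m ∈ (Icc 1 (⌊x⌋₊ / n)).filter (fun m : ℕ => Nat.Coprime m n),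
          α m * polyRootWeylSum f (m * n) h) - fiberSum f h α β (S k) (X k)‖ ≤
        ∑ n ∈ S k, errTerm n := by
    intro k _
    exact norm_fiber_sub_fiberSum_le (Nk := N k) (Nk1 := N (k + 1)) hC (hρ h) hα hβ hβp hx1
      hΔ0.le (hN0 k) (le_of_eq (hNsucc k))
      (fun n hn => ⟨(hSmem k n hn).1.1, (hSmem k n hn).1.2.1, (hSmem k n hn).2.1, (hSmem k n hn).2.2⟩)
  have hF₂sub : F₂ ⊆ Icc 1 ⌊y⌋₊ := fun n hn => by
    obtain ⟨h1, -, -, h4⟩ := hF₂mem n hn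
    exact Finset.mem_Icc.2 ⟨h1, Nat.le_floor h4.le⟩
  have herrsum : ∑ n ∈ F₂, errTerm n ≤
      8 * C * Real.log x * (L * (Δ * x * L + y) + y * Real.sqrt x) := by
    have hsplit : ∀ n ∈ F₂, errTerm n =
        8 * C * Real.log x * (L * Δ * x) * ((n : ℝ))⁻¹ + 8 * C * Real.log x * (L + Real.sqrt x) := by
      intro n _; rw [herr, hL]; ring
    rw [Finset.sum_congr rfl hsplit, Finset.sum_add_distrib, ← Finset.mul_sum, Finset.sum_const,
      nsmul_eq_mul]
    have hinv : ∑ n ∈ F₂, ((n : ℝ))⁻¹ ≤ L := by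
      calc ∑ n ∈ F₂, ((n : ℝ))⁻¹ ≤ ∑ n ∈ Icc 1 ⌊y⌋₊, ((n : ℝ))⁻¹ :=
            Finset.sum_le_sum_of_subset_of_nonneg hF₂sub fun _ _ _ => by positivity
        _ ≤ 1 + Real.log ⌊y⌋₊ := by
            have := Vaughan.sum_Ioc_inv_le ⌊y⌋₊
            rwa [Vaughan.Ioc_zero_eq_Icc_one] at this
        _ ≤ L := by
            rw [hL]
            have : Real.log (⌊y⌋₊ : ℝ) ≤ Real.log x := by
              rcases Nat.eq_zero_or_pos ⌊y⌋₊ with h0 | hpos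
              · rw [h0, Nat.cast_zero, Real.log_zero]; exact hlx0
              · exact Real.log_le_log (by exact_mod_cast hpos) ((Nat.floor_le hy0).trans hyx)
            linarith
    have hcardF : (F₂.card : ℝ) ≤ y := by
      calc (F₂.card : ℝ) ≤ ((Icc 1 ⌊y⌋₊).card : ℝ) := by exact_mod_cast Finset.card_le_card hF₂sub
        _ = ⌊y⌋₊ := by rw [Nat.card_Icc]; push_cast; ring
        _ ≤ y := Nat.floor_le hy0
    have h8 : 0 ≤ 8 * C * Real.log x := by positivity
    calc 8 * C * Real.log x * (L * Δ * x) * ∑ n ∈ F₂, ((n : ℝ))⁻¹ +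
          (F₂.card : ℝ) * (8 * C * Real.log x * (L + Real.sqrt x))
        ≤ 8 * C * Real.log x * (L * Δ * x) * L + y * (8 * C * Real.log x * (L + Real.sqrt x)) := by
          gcongr
      _ = 8 * C * Real.log x * (L * (Δ * x * L + y) + y * Real.sqrt x) := by ring
  -- Step 4: the main term on each fibre
  have hmaink : ∀ k ∈ Finset.range Kmax, ‖fiberSum f h α β (S k) (X k)‖ ≤ MainFib := by
    intro k _
    have := norm_fiberSum_fiber_le_of_exponents (S := S k) hC hK₂ hb0 hab (hρ 0) hα hβ
      (fun M hM S' hS' => hK₂all M (N (k + 1) / 2) hM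
        (by have := hNge (k + 1); linarith) α β S' hS' hβp)
      hx1 hw hy0 hΔ0 hΔ (hNge k) (hNsucc k)
      (fun n hn => ⟨(hSmem k n hn).1.1, (hSmem k n hn).1.2.2.2, (hSmem k n hn).2.1,
        (hSmem k n hn).2.2⟩)
    simpa only [hXdef, hMainFib, hL] using this
  -- Step 5: assemble
  rw [hR]
  calc ‖∑ k ∈ Finset.range Kmax, ∑ n ∈ S k, β n *
        ∑ m ∈ (Icc 1 (⌊x⌋₊ / n)).filter (fun m : ℕ => Nat.Coprime m n), α m * polyRootWeylSum f (m * n) h‖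
      ≤ ∑ k ∈ Finset.range Kmax, ‖∑ n ∈ S k, β n *
        ∑ m ∈ (Icc 1 (⌊x⌋₊ / n)).filter (fun m : ℕ => Nat.Coprime m n), α m * polyRootWeylSum f (m * n) h‖ :=
        norm_sum_le _ _
    _ ≤ ∑ k ∈ Finset.range Kmax, (∑ n ∈ S k, errTerm n + MainFib) := by
        refine Finset.sum_le_sum fun k hk => ?_
        calc ‖∑ n ∈ S k, β n * ∑ m ∈ (Icc 1 (⌊x⌋₊ / n)).filter (fun m : ℕ => Nat.Coprime m n),
              α m * polyRootWeylSum f (m * n) h‖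
            = ‖((∑ n ∈ S k, β n * ∑ m ∈ (Icc 1 (⌊x⌋₊ / n)).filter (fun m : ℕ => Nat.Coprime m n),
                α m * polyRootWeylSum f (m * n) h) - fiberSum f h α β (S k) (X k)) +
                fiberSum f h α β (S k) (X k)‖ := by rw [sub_add_cancel]
          _ ≤ ‖(∑ n ∈ S k, β n * ∑ m ∈ (Icc 1 (⌊x⌋₊ / n)).filter (fun m : ℕ => Nat.Coprime m n),
                α m * polyRootWeylSum f (m * n) h) - fiberSum f h α β (S k) (X k)‖ +
                ‖fiberSum f h α β (S k) (X k)‖ := norm_add_le _ _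
          _ ≤ ∑ n ∈ S k, errTerm n + MainFib := add_le_add (herrk k hk) (hmaink k hk)
    _ = ∑ n ∈ F₂, errTerm n + Kmax * MainFib := by
        rw [Finset.sum_add_distrib, ← Finset.sum_biUnion hdisj, ← hcover, Finset.sum_const,
          Finset.card_range, nsmul_eq_mul]
    _ ≤ 8 * C * Real.log x * (L * (Δ * x * L + y) + y * Real.sqrt x) + Kmax * MainFib :=
        add_le_add herrsum le_rfl


/-! ### The final bookkeeping and (35) -/

/-- The final bookkeeping of `hyp35_of_bilinearFormBound`: with `L = 1 + log x`, `Δ = L^{−14}`,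
the bound of `norm_sieveR₂_rho_le_of_exponents` is `≤ (8C + 3) x (log x)^{−10}` once
`(64C+1)(log x)^{12} ≤ x^{1/6}`, `C_P (log x)^{29} ≤ x^κ` and `2(|log C_M| + 29) u⁴ ≤ e^u`
(`u = log log x`), where `x^{1/2+b} y^{a−b} = x^{1−κ}` for `y = x^{1/3−ε}`, i.e.
`κ = 1/2 − b − (1/3 − ε)(a − b)`; the argument of `DFI1995.hyp35_final_bound` (the case
`a = 3/4`, `b = 3/8 + ε/8`, there with the saving `ε/4 ≤ κ`). [folklore] -/
theorem hyp35_final_bound_of_exponents {Cρ K₂ ε x w y CM CP u a b κ : ℝ} (hCρ0 : 0 ≤ Cρ)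
    (hK₂ : 0 ≤ K₂) (hκ : κ = 1 / 2 - b - (1 / 3 - ε) * (a - b))
    (hCM : CM = 12 * Real.sqrt 2 * 2 ^ 19 * K₂ * Cρ + 1)
    (hCP : CP = 12 * Real.sqrt 3 * 2 ^ 19 * K₂ * Cρ + 1)
    (hx1 : 1 ≤ x) (hlogx : 1 ≤ Real.log x) (heu : Real.exp u = Real.log x) (hu1' : 1 ≤ u)
    (hgrowth : 2 * (|Real.log CM| + 29) * u ^ 4 ≤ Real.exp u)
    (h64 : (64 * Cρ + 1) * Real.log x ^ 12 ≤ x ^ (1 / 6 : ℝ))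
    (hCPb : CP * Real.log x ^ 29 ≤ x ^ κ)
    (hsqrtw : Real.sqrt w = Real.exp (Real.exp u / (2 * u ^ 3))) (hw1 : 1 ≤ w)
    (hy : y = x ^ (1 / 3 - ε)) (hy0 : 0 < y) (hyx : y ≤ x) (hy13 : y ≤ x ^ (1 / 3 : ℝ)) :
    8 * Cρ * Real.log x * ((1 + Real.log x) * ((1 + Real.log x)⁻¹ ^ 14 * x * (1 + Real.log x) + y) +
        y * Real.sqrt x) +
      (⌈Real.log (y / w) / Real.log (1 + (1 + Real.log x)⁻¹ ^ 14)⌉₊ : ℝ) *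
        ((2 * Real.log x + 1) * (K₂ * (2 * Cρ * Real.log x) * Real.sqrt ((1 + Real.log x) ^ 3)) *
          (Real.sqrt 2 * x / Real.sqrt w + Real.sqrt 3 * x ^ (1 / 2 + b) * y ^ (a - b))) ≤
      (8 * Cρ + 3) * x / Real.log x ^ 10 := by
  have hx0 : 0 < x := by linarith
  have hCM0 : 0 < CM := by rw [hCM]; positivity
  have hu0 : 0 < u := by linarith
  set L : ℝ := 1 + Real.log x with hL
  have hL1 : 1 ≤ L := by linarith
  have hLlog : Real.log x ≤ L := by linarith
  have hL2log : L ≤ 2 * Real.log x := by linarith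
  set Δ : ℝ := L⁻¹ ^ 14 with hΔ
  have hΔ0 : 0 < Δ := by positivity
  have hΔ1 : Δ ≤ 1 := by
    rw [hΔ, inv_pow]; exact inv_le_one_of_one_le₀ (one_le_pow₀ hL1)
  have hlx0 : 0 < Real.log x := by linarith
  have hl10 : 0 < Real.log x ^ 10 := by positivity
  set Q : ℝ := x / Real.log x ^ 10 with hQ
  have hQ0 : 0 ≤ Q := by positivity
  -- (E1) `8 Cρ log x · L · Δ x L ≤ 8 Cρ Q`
  have hE1 : 8 * Cρ * Real.log x * ((1 + Real.log x) * ((1 + Real.log x)⁻¹ ^ 14 * x * (1 + Real.log x))) ≤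
      8 * Cρ * Q := by
    rw [← hL]
    have h1 : Real.log x * (L * (L⁻¹ ^ 14 * x * L)) = x * (Real.log x / L ^ 12) := by
      have hL0 : L ≠ 0 := by linarith
      rw [inv_pow]
      field_simp
    rw [mul_assoc (8 * Cρ), h1, hQ]
    refine mul_le_mul_of_nonneg_left ?_ (by positivity)
    rw [mul_div_assoc']
    rw [div_le_div_iff₀ (by positivity) hl10]
    have h2 : Real.log x ^ 11 ≤ L ^ 11 := pow_le_pow_left₀ hlx0.le hLlog 11
    have h3 : L ^ 11 ≤ L ^ 12 := pow_le_pow_right₀ hL1 (by norm_num)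
    calc x * Real.log x * Real.log x ^ 10 = x * Real.log x ^ 11 := by ring
      _ ≤ x * L ^ 12 := by gcongr; exact h2.trans h3
  -- (E2) `8 Cρ log x (L y + y √x) ≤ Q`
  have hE2 : 8 * Cρ * Real.log x * ((1 + Real.log x) * y + y * Real.sqrt x) ≤ Q := by
    rw [← hL]
    have hsx1 : 1 ≤ Real.sqrt x := by rw [← Real.sqrt_one]; exact Real.sqrt_le_sqrt hx1
    have h1 : L * y + y * Real.sqrt x ≤ 2 * L * Real.sqrt x * y := by
      have ha : L * y ≤ L * Real.sqrt x * y := by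
        calc L * y = L * 1 * y := by ring
          _ ≤ L * Real.sqrt x * y := by gcongr
      have hb : y * Real.sqrt x ≤ L * Real.sqrt x * y := by
        calc y * Real.sqrt x = 1 * Real.sqrt x * y := by ring
          _ ≤ L * Real.sqrt x * y := by gcongr
      linarith
    have h2 : Real.sqrt x * y ≤ x ^ (5 / 6 : ℝ) := by
      rw [Real.sqrt_eq_rpow]
      calc x ^ (1 / 2 : ℝ) * y ≤ x ^ (1 / 2 : ℝ) * x ^ (1 / 3 : ℝ) :=
            mul_le_mul_of_nonneg_left hy13 (by positivity)
        _ = x ^ (5 / 6 : ℝ) := by rw [← Real.rpow_add hx0]; norm_num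
    have h3 : (64 * Cρ + 1) * Real.log x ^ 12 ≤ x ^ (1 / 6 : ℝ) := h64
    have h4 : x ^ (5 / 6 : ℝ) * x ^ (1 / 6 : ℝ) = x := by
      rw [← Real.rpow_add hx0]; norm_num
    calc 8 * Cρ * Real.log x * (L * y + y * Real.sqrt x)
        ≤ 8 * Cρ * Real.log x * (2 * L * Real.sqrt x * y) := by gcongr
      _ = 16 * Cρ * (Real.log x * L) * (Real.sqrt x * y) := by ring
      _ ≤ 16 * Cρ * (Real.log x * (2 * Real.log x)) * x ^ (5 / 6 : ℝ) := by gcongr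
      _ = (32 * Cρ * Real.log x ^ 12) * x ^ (5 / 6 : ℝ) / Real.log x ^ 10 := by
          field_simp; ring
      _ ≤ x ^ (1 / 6 : ℝ) * x ^ (5 / 6 : ℝ) / Real.log x ^ 10 := by
          gcongr
          nlinarith [pow_nonneg hlx0.le 12]
      _ = Q := by rw [hQ, mul_comm, h4]
  -- (K) the number of fibres
  have hK : (⌈Real.log (y / w) / Real.log (1 + (1 + Real.log x)⁻¹ ^ 14)⌉₊ : ℝ) ≤ 3 * L ^ 15 := by
    rw [← hL, ← hΔ]
    refine (natCeil_log_div_log_le hx1 hw1 hy0 hyx hΔ0 hΔ1).trans ?_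
    have h1 : 2 * Real.log x / Δ = 2 * Real.log x * L ^ 14 := by
      rw [hΔ, inv_pow]; field_simp
    rw [h1]
    have h2 : (1 : ℝ) ≤ L ^ 15 := one_le_pow₀ hL1
    calc 2 * Real.log x * L ^ 14 + 1 ≤ 2 * L * L ^ 14 + L ^ 15 := by gcongr
      _ = 3 * L ^ 15 := by ring
  -- (MF) the fibre bound in terms of `L`
  have hMF : (2 * Real.log x + 1) * (K₂ * (2 * Cρ * Real.log x) * Real.sqrt ((1 + Real.log x) ^ 3)) ≤
      4 * K₂ * Cρ * L ^ 4 := by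
    rw [← hL]
    have h1 : Real.sqrt (L ^ 3) ≤ L ^ 2 := by
      rw [show L ^ 2 = Real.sqrt (L ^ 4) by
        rw [show L ^ 4 = (L ^ 2) ^ 2 by ring, Real.sqrt_sq (by positivity)]]
      exact Real.sqrt_le_sqrt (pow_le_pow_right₀ hL1 (by norm_num))
    calc (2 * Real.log x + 1) * (K₂ * (2 * Cρ * Real.log x) * Real.sqrt (L ^ 3))
        ≤ (2 * L) * (K₂ * (2 * Cρ * L) * L ^ 2) := by gcongr; linarith
      _ = 4 * K₂ * Cρ * L ^ 4 := by ring
  -- (M1) the `w`-term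
  have hM1 : 3 * L ^ 15 * (4 * K₂ * Cρ * L ^ 4) * (Real.sqrt 2 * x / Real.sqrt w) ≤ Q := by
    have hsw0 : 0 < Real.sqrt w := Real.sqrt_pos.2 (by linarith)
    -- `CM (log x)^29 ≤ √w`
    have hgr : CM * Real.log x ^ 29 ≤ Real.sqrt w := by
      have h1 : CM * Real.log x ^ 29 = Real.exp (Real.log CM + 29 * u) := by
        rw [Real.exp_add, Real.exp_log hCM0, ← heu, ← Real.exp_nat_mul]; norm_num
      rw [h1, hsqrtw, Real.exp_le_exp, le_div_iff₀ (by positivity)]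
      have h2 : Real.log CM ≤ |Real.log CM| * u := by
        calc Real.log CM ≤ |Real.log CM| := le_abs_self _
          _ = |Real.log CM| * 1 := (mul_one _).symm
          _ ≤ |Real.log CM| * u := by gcongr
      have h5 : Real.log CM * (2 * u ^ 3) ≤ |Real.log CM| * u * (2 * u ^ 3) :=
        mul_le_mul_of_nonneg_right h2 (by positivity)
      calc (Real.log CM + 29 * u) * (2 * u ^ 3)
          = Real.log CM * (2 * u ^ 3) + 29 * u * (2 * u ^ 3) := by ring
        _ ≤ |Real.log CM| * u * (2 * u ^ 3) + 29 * u * (2 * u ^ 3) := by linarith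
        _ = 2 * (|Real.log CM| + 29) * u ^ 4 := by ring
        _ ≤ Real.exp u := hgrowth
    have hL19 : L ^ 19 ≤ 2 ^ 19 * Real.log x ^ 19 :=
      calc L ^ 19 ≤ (2 * Real.log x) ^ 19 := pow_le_pow_left₀ (by linarith) hL2log 19
        _ = 2 ^ 19 * Real.log x ^ 19 := mul_pow _ _ _
    have hcoef : 3 * L ^ 15 * (4 * K₂ * Cρ * L ^ 4) * Real.sqrt 2 ≤ CM * Real.log x ^ 19 := by
      have hc1 : 12 * Real.sqrt 2 * 2 ^ 19 * K₂ * Cρ ≤ CM := by rw [hCM]; linarith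
      calc 3 * L ^ 15 * (4 * K₂ * Cρ * L ^ 4) * Real.sqrt 2 = 12 * Real.sqrt 2 * K₂ * Cρ * L ^ 19 := by ring
        _ ≤ 12 * Real.sqrt 2 * K₂ * Cρ * (2 ^ 19 * Real.log x ^ 19) :=
            mul_le_mul_of_nonneg_left hL19 (by positivity)
        _ = (12 * Real.sqrt 2 * 2 ^ 19 * K₂ * Cρ) * Real.log x ^ 19 := by ring
        _ ≤ CM * Real.log x ^ 19 := mul_le_mul_of_nonneg_right hc1 (by positivity)
    calc 3 * L ^ 15 * (4 * K₂ * Cρ * L ^ 4) * (Real.sqrt 2 * x / Real.sqrt w)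
        = (3 * L ^ 15 * (4 * K₂ * Cρ * L ^ 4) * Real.sqrt 2) * (x / Real.sqrt w) := by ring
      _ ≤ (CM * Real.log x ^ 19) * (x / Real.sqrt w) :=
          mul_le_mul_of_nonneg_right hcoef (by positivity)
      _ = (CM * Real.log x ^ 29 / Real.sqrt w) * Q := by
          rw [hQ]; field_simp
      _ ≤ 1 * Q := by
          refine mul_le_mul_of_nonneg_right ?_ hQ0
          rw [div_le_one hsw0]; exact hgr
      _ = Q := one_mul Q
  -- (M2) the power-saving term
  have hM2 : 3 * L ^ 15 * (4 * K₂ * Cρ * L ^ 4) *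
      (Real.sqrt 3 * x ^ (1 / 2 + b) * y ^ (a - b)) ≤ Q := by
    have hCP0 : 0 < CP := by rw [hCP]; positivity
    have hpow : x ^ (1 / 2 + b) * y ^ (a - b) = x ^ (1 - κ) := by
      rw [hy, ← Real.rpow_mul hx0.le, ← Real.rpow_add hx0, hκ]
      congr 1; ring
    have hgr : CP * Real.log x ^ 29 ≤ x ^ κ := hCPb
    have hL19 : L ^ 19 ≤ 2 ^ 19 * Real.log x ^ 19 :=
      calc L ^ 19 ≤ (2 * Real.log x) ^ 19 := pow_le_pow_left₀ (by linarith) hL2log 19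
        _ = 2 ^ 19 * Real.log x ^ 19 := mul_pow _ _ _
    have hcoef : 3 * L ^ 15 * (4 * K₂ * Cρ * L ^ 4) * Real.sqrt 3 ≤ CP * Real.log x ^ 19 := by
      have hc1 : 12 * Real.sqrt 3 * 2 ^ 19 * K₂ * Cρ ≤ CP := by rw [hCP]; linarith
      calc 3 * L ^ 15 * (4 * K₂ * Cρ * L ^ 4) * Real.sqrt 3 = 12 * Real.sqrt 3 * K₂ * Cρ * L ^ 19 := by ring
        _ ≤ 12 * Real.sqrt 3 * K₂ * Cρ * (2 ^ 19 * Real.log x ^ 19) :=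
            mul_le_mul_of_nonneg_left hL19 (by positivity)
        _ = (12 * Real.sqrt 3 * 2 ^ 19 * K₂ * Cρ) * Real.log x ^ 19 := by ring
        _ ≤ CP * Real.log x ^ 19 := mul_le_mul_of_nonneg_right hc1 (by positivity)
    have hx1e : x ^ κ * x ^ (1 - κ) = x := by
      rw [← Real.rpow_add hx0, show κ + (1 - κ) = (1 : ℝ) by ring, Real.rpow_one]
    calc 3 * L ^ 15 * (4 * K₂ * Cρ * L ^ 4) * (Real.sqrt 3 * x ^ (1 / 2 + b) * y ^ (a - b))
        = (3 * L ^ 15 * (4 * K₂ * Cρ * L ^ 4) * Real.sqrt 3) * (x ^ (1 / 2 + b) * y ^ (a - b)) := by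
          ring
      _ ≤ (CP * Real.log x ^ 19) * x ^ (1 - κ) := by
          rw [hpow]; exact mul_le_mul_of_nonneg_right hcoef (by positivity)
      _ = (CP * Real.log x ^ 29) * x ^ (1 - κ) / Real.log x ^ 10 := by
          field_simp
      _ ≤ x ^ κ * x ^ (1 - κ) / Real.log x ^ 10 := by gcongr
      _ = Q := by rw [hx1e]
  -- assemble
  have hKM : (⌈Real.log (y / w) / Real.log (1 + (1 + Real.log x)⁻¹ ^ 14)⌉₊ : ℝ) *
      ((2 * Real.log x + 1) * (K₂ * (2 * Cρ * Real.log x) * Real.sqrt ((1 + Real.log x) ^ 3)) *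
        (Real.sqrt 2 * x / Real.sqrt w + Real.sqrt 3 * x ^ (1 / 2 + b) * y ^ (a - b))) ≤ Q + Q := by
    have hT0 : 0 ≤ Real.sqrt 2 * x / Real.sqrt w + Real.sqrt 3 * x ^ (1 / 2 + b) * y ^ (a - b) := by
      have : 0 ≤ y ^ (a - b) := Real.rpow_nonneg hy0.le _
      positivity
    calc _ ≤ (3 * L ^ 15) * ((4 * K₂ * Cρ * L ^ 4) *
          (Real.sqrt 2 * x / Real.sqrt w + Real.sqrt 3 * x ^ (1 / 2 + b) * y ^ (a - b))) := by
          apply mul_le_mul hK (mul_le_mul_of_nonneg_right hMF hT0) (by positivity) (by positivity)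
      _ = 3 * L ^ 15 * (4 * K₂ * Cρ * L ^ 4) * (Real.sqrt 2 * x / Real.sqrt w) +
          3 * L ^ 15 * (4 * K₂ * Cρ * L ^ 4) * (Real.sqrt 3 * x ^ (1 / 2 + b) * y ^ (a - b)) := by
          ring
      _ ≤ Q + Q := add_le_add hM1 hM2
  have hE : 8 * Cρ * Real.log x * ((1 + Real.log x) * ((1 + Real.log x)⁻¹ ^ 14 * x * (1 + Real.log x) + y) +
      y * Real.sqrt x) ≤ 8 * Cρ * Q + Q := by
    have : 8 * Cρ * Real.log x * ((1 + Real.log x) * ((1 + Real.log x)⁻¹ ^ 14 * x * (1 + Real.log x) + y) +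
        y * Real.sqrt x) =
        8 * Cρ * Real.log x * ((1 + Real.log x) * ((1 + Real.log x)⁻¹ ^ 14 * x * (1 + Real.log x))) +
          8 * Cρ * Real.log x * ((1 + Real.log x) * y + y * Real.sqrt x) := by ring
    rw [this]
    exact add_le_add hE1 hE2
  calc _ ≤ (8 * Cρ * Q + Q) + (Q + Q) := add_le_add hE hKM
    _ = (8 * Cρ + 3) * x / Real.log x ^ 10 := by rw [hQ]; ring

/-! ### (35) from a bilinear-form bound of shape `M^{1/2} + N^a M^b` -/

/-- **(35) for `ρ_h` from a bilinear-form bound of shape `M^{1/2} + N^a M^b` (PROVED).**  Let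
`f ∈ ℤ[X]`, `h ∈ ℤ`, with `|ρ_{h'}(n)| ≤ C τ(n)` for all `h'` (used for `h' = h` and `h' = 0`),
`0 < ε`, `0 ≤ b ≤ a` with `κ = 1/2 − b − (1/3 − ε)(a − b) > 0`, and suppose the blocks of the
general bilinear form satisfy
`|B(M, N')(α|_{(M,2M]}, β|_S)| ≤ K₂ ‖αρ‖ ‖β‖ (M^{1/2} + N'^a M^b)` for all `M, N' ≥ 1`, all
`S ⊆ (N', 2N']` and all `β` supported on primes.  Then hypothesis (35) of DFI's Theorem 5 holds
for `c_n = ρ_h(n)`: `R(w, y) ≪ x (log x)^{−10}` with `y = x^{1/3−ε}`, `w = x^{(log log x)^{−3}}`,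
uniformly in `|α_m| ≤ ω(m)`, `|β_n| ≤ 1` supported on primes.  The argument is that of
`DFI1995.hyp35_of_proposition2` [cite: DukeFriedlanderIwaniec1995, §7 p. 438] (short
multiplicative fibres in `n`, dyadic blocks in `m`, the hypothesis on each block): the diagonal
term contributes `≪ (log x)^{19} x/√w` and the second term `≪ (log x)^{19} x^{1/2+b} y^{a−b}
= (log x)^{19} x^{1−κ}`.  DFI's Proposition 2 is `(a, b) = (3/4, 3/8 + ε')`; Tóth's bilinear
estimate for positive discriminant [cite: Toth2000, main theorem] is to be fed in the same way.
[cite: DukeFriedlanderIwaniec1995, §7 p. 438 with (33), (35)] -/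
theorem hyp35_of_bilinearFormBound {f : ℤ[X]} {h : ℤ} {Cρ K₂ a b ε : ℝ} (hCρ0 : 0 ≤ Cρ)
    (hK₂ : 0 ≤ K₂)
    (hρ : ∀ h' : ℤ, ∀ n : ℕ, 1 ≤ n → ‖polyRootWeylSum f n h'‖ ≤ Cρ * (Nat.divisors n).card)
    (hε : 0 < ε) (hb0 : 0 ≤ b) (hab : b ≤ a) (hκ0 : 0 < 1 / 2 - b - (1 / 3 - ε) * (a - b))
    (hK₂all : ∀ M N' : ℝ, 1 ≤ M → 1 ≤ N' → ∀ (α β : ℕ → ℂ) (S : Finset ℕ),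
      (∀ n ∈ S, N' < (n : ℝ) ∧ (n : ℝ) ≤ 2 * N') → (∀ n : ℕ, ¬ n.Prime → β n = 0) →
      ‖bilinearForm f h (blockAlpha α M) (fiberBeta β S) M N'‖ ≤
        K₂ * normAlphaRho f (blockAlpha α M) M * l2Norm (fiberBeta β S) N' *
          (M ^ (1 / 2 : ℝ) + N' ^ a * M ^ b)) :
    Hyp35 f h ε := by
  set κ : ℝ := 1 / 2 - b - (1 / 3 - ε) * (a - b) with hκ
  -- thresholds
  -- (a) the growth lemma for `u = log log x`
  set CM : ℝ := 12 * Real.sqrt 2 * 2 ^ 19 * K₂ * Cρ + 1 with hCM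
  have hCM0 : 0 < CM := by positivity
  obtain ⟨u₀, hu₀⟩ := exists_pow_four_mul_le_exp (2 * (|Real.log CM| + 29))
  -- (b) `64 Cρ (log x)^12 ≤ x^{1/6}` and (c) `C (log x)^29 ≤ x^κ` eventually
  have hb := (isLittleO_log_rpow_rpow_atTop (12 : ℝ) (by norm_num : (0 : ℝ) < 1 / 6)).bound
    (show (0 : ℝ) < 1 / (64 * Cρ + 1) by positivity)
  obtain ⟨x₂, hx₂⟩ := Filter.eventually_atTop.1 hb
  set CP : ℝ := 12 * Real.sqrt 3 * 2 ^ 19 * K₂ * Cρ + 1 with hCP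
  have hc := (isLittleO_log_rpow_rpow_atTop (29 : ℝ) hκ0).bound (show (0 : ℝ) < 1 / CP by positivity)
  obtain ⟨x₃, hx₃⟩ := Filter.eventually_atTop.1 hc
  set x₁ : ℝ := max (max (Real.exp (Real.exp (max u₀ 1))) (Real.exp 1)) (max x₂ x₃) with hx₁
  refine ⟨x₁, 8 * Cρ + 3, fun x hx α β hα hβ hβp => ?_⟩
  have hxu : Real.exp (Real.exp (max u₀ 1)) ≤ x := le_trans (le_trans (le_max_left _ _) (le_max_left _ _)) hx
  have hxe : Real.exp 1 ≤ x := le_trans (le_trans (le_max_right _ _) (le_max_left _ _)) hx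
  have hx₂x : x₂ ≤ x := le_trans (le_trans (le_max_left _ _) (le_max_right _ _)) hx
  have hx₃x : x₃ ≤ x := le_trans (le_trans (le_max_right _ _) (le_max_right _ _)) hx
  have hx1 : (1 : ℝ) ≤ x := le_trans (by have := Real.add_one_le_exp (1 : ℝ); linarith) hxe
  have hx0 : (0 : ℝ) < x := by linarith
  have hlogx : 1 ≤ Real.log x := by
    rw [← Real.log_exp 1]; exact Real.log_le_log (Real.exp_pos 1) hxe
  set u : ℝ := Real.log (Real.log x) with hu
  have hu1 : max u₀ 1 ≤ u := by
    have h1 : Real.exp (max u₀ 1) ≤ Real.log x := by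
      rw [← Real.log_exp (Real.exp (max u₀ 1))]
      exact Real.log_le_log (Real.exp_pos _) hxu
    rw [hu, ← Real.log_exp (max u₀ 1)]
    exact Real.log_le_log (Real.exp_pos _) h1
  have hu1' : 1 ≤ u := le_trans (le_max_right _ _) hu1
  have heu : Real.exp u = Real.log x := by rw [hu, Real.exp_log (by linarith)]
  have hgrowth : 2 * (|Real.log CM| + 29) * u ^ 4 ≤ Real.exp u := hu₀ u (le_trans (le_max_left _ _) hu1)
  -- the parameters
  set w : ℝ := x ^ ((Real.log (Real.log x))⁻¹ ^ 3) with hw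
  set y : ℝ := x ^ (1 / 3 - ε) with hy
  have hy0 : 0 < y := Real.rpow_pos_of_pos hx0 _
  have hyx : y ≤ x := by
    calc y ≤ x ^ (1 : ℝ) := Real.rpow_le_rpow_of_exponent_le hx1 (by linarith)
      _ = x := Real.rpow_one x
  have hy13 : y ≤ x ^ (1 / 3 : ℝ) := Real.rpow_le_rpow_of_exponent_le hx1 (by linarith)
  -- `√w = exp(e^u/(2u³))` and `w ≥ 2`
  have hsqrtw : Real.sqrt w = Real.exp (Real.exp u / (2 * u ^ 3)) := by
    rw [hw, Real.rpow_def_of_pos hx0, ← Real.exp_half, ← hu, heu]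
    congr 1
    field_simp
  have hu0 : 0 < u := by linarith
  have hexpu : u ^ 3 * u ≤ Real.exp u := by
    have h58 : (1 : ℝ) ≤ 2 * (|Real.log CM| + 29) := by
      have := abs_nonneg (Real.log CM); linarith
    calc u ^ 3 * u = 1 * u ^ 4 := by ring
      _ ≤ 2 * (|Real.log CM| + 29) * u ^ 4 := by gcongr
      _ ≤ Real.exp u := hgrowth
  have hw2 : 2 ≤ w := by
    have h1 : Real.log 2 ≤ Real.exp u / (2 * u ^ 3) * 2 := by
      rw [div_mul_eq_mul_div, le_div_iff₀ (by positivity)]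
      have hl2 := Real.log_two_lt_d9
      have hu3 : 0 ≤ u ^ 3 := pow_nonneg hu0.le 3
      have h3 : u ^ 3 ≤ Real.exp u := le_trans (by nlinarith) hexpu
      nlinarith
    have h2 : (2 : ℝ) ≤ Real.sqrt w * Real.sqrt w := by
      rw [hsqrtw, ← Real.exp_add, ← two_mul]
      calc (2 : ℝ) = Real.exp (Real.log 2) := (Real.exp_log (by norm_num)).symm
        _ ≤ Real.exp (2 * (Real.exp u / (2 * u ^ 3))) := Real.exp_le_exp.2 (by linarith)
    have hw0 : 0 ≤ w := by rw [hw]; exact Real.rpow_nonneg hx0.le _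
    rwa [Real.mul_self_sqrt hw0] at h2
  have hw1 : 1 ≤ w := by linarith
  -- the bound at `x`
  have hmain := norm_sieveR₂_rho_le_of_exponents (f := f) (h := h) (w := w) (y := y) (α := α) (β := β)
    hCρ0 hK₂ hb0 hab hρ hK₂all hα hβ hβp hxe hw2 hy0.le hyx
  refine hmain.trans ?_
  have h64 : (64 * Cρ + 1) * Real.log x ^ 12 ≤ x ^ (1 / 6 : ℝ) := by
    have := hx₂ x hx₂x
    rw [show (12 : ℝ) = ((12 : ℕ) : ℝ) by norm_num, Real.rpow_natCast,
      Real.norm_of_nonneg (by positivity), Real.norm_of_nonneg (by positivity)] at this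
    rw [← le_div_iff₀' (by positivity)]
    simpa [one_div, div_eq_inv_mul] using this
  have hCP0 : 0 < CP := by positivity
  have hCPb : CP * Real.log x ^ 29 ≤ x ^ κ := by
    have := hx₃ x hx₃x
    rw [show (29 : ℝ) = ((29 : ℕ) : ℝ) by norm_num, Real.rpow_natCast,
      Real.norm_of_nonneg (by positivity), Real.norm_of_nonneg (by positivity)] at this
    rw [← le_div_iff₀' hCP0]
    simpa [one_div, div_eq_inv_mul] using this
  exact hyp35_final_bound_of_exponents hCρ0 hK₂ hκ hCM hCP hx1 hlogx heu hu1' hgrowth h64 hCPb hsqrtw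
    hw1 hy hy0 hyx hy13

/-- **(35) from DFI's shape, general `f`**: if for every `ε' > 0` there is `K₂` with
`|B(M, N')(α|_{(M,2M]}, β|_S)| ≤ K₂ ‖αρ‖ ‖β‖ (M^{1/2} + N'^{3/4} M^{3/8+ε'})` (blocks as above; the
shape of [cite: DukeFriedlanderIwaniec1995, Proposition 2 (10)]), then (35) holds for
`c_n = ρ_h(n)` for every `0 < ε ≤ 1/12` (`ε' = ε/8`: `κ = 3ε/8 − (ε/8)(2/3 + ε) = 7ε/24 − ε²/8 > 0`).
For `f = aX² + 2bX + c`, `ac > b²` this is `DFI1995.hyp35_of_proposition2`.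
[cite: DukeFriedlanderIwaniec1995, §7 p. 438] -/
theorem hyp35_of_bilinearFormBound_dfi {f : ℤ[X]} {h : ℤ} {Cρ : ℝ} (hCρ0 : 0 ≤ Cρ)
    (hρ : ∀ h' : ℤ, ∀ n : ℕ, 1 ≤ n → ‖polyRootWeylSum f n h'‖ ≤ Cρ * (Nat.divisors n).card)
    (h2 : ∀ ε' : ℝ, 0 < ε' → ∃ K₂ : ℝ, ∀ M N' : ℝ, 1 ≤ M → 1 ≤ N' → ∀ (α β : ℕ → ℂ) (S : Finset ℕ),
      (∀ n ∈ S, N' < (n : ℝ) ∧ (n : ℝ) ≤ 2 * N') → (∀ n : ℕ, ¬ n.Prime → β n = 0) →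
      ‖bilinearForm f h (blockAlpha α M) (fiberBeta β S) M N'‖ ≤
        K₂ * normAlphaRho f (blockAlpha α M) M * l2Norm (fiberBeta β S) N' *
          (M ^ (1 / 2 : ℝ) + N' ^ (3 / 4 : ℝ) * M ^ (3 / 8 + ε')))
    {ε : ℝ} (hε : 0 < ε) (hε12 : ε ≤ 1 / 12) : Hyp35 f h ε := by
  obtain ⟨K₂, hK₂⟩ := h2 (ε / 8) (by positivity)
  have hκ0 : 0 < 1 / 2 - (3 / 8 + ε / 8) - (1 / 3 - ε) * (3 / 4 - (3 / 8 + ε / 8)) := by nlinarith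
  refine hyp35_of_bilinearFormBound (K₂ := max K₂ 0) (a := 3 / 4) (b := 3 / 8 + ε / 8) hCρ0
    (le_max_right _ _) hρ hε (by positivity) (by linarith) hκ0 fun M N' hM hN' α β S hS hβ => ?_
  refine (hK₂ M N' hM hN' α β S hS hβ).trans ?_
  have h0 : 0 ≤ normAlphaRho f (blockAlpha α M) M := by unfold normAlphaRho; positivity
  have h1 : 0 ≤ l2Norm (fiberBeta β S) N' := by unfold l2Norm; positivity
  have hM0 : 0 ≤ M := by linarith
  have hN'0 : 0 ≤ N' := by linarith
  have h3 : 0 ≤ M ^ (1 / 2 : ℝ) + N' ^ (3 / 4 : ℝ) * M ^ (3 / 8 + ε / 8) := by positivity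
  exact mul_le_mul_of_nonneg_right (mul_le_mul_of_nonneg_right
    (mul_le_mul_of_nonneg_right (le_max_left _ _) h0) h1) h3

end DFI1995

end Literature.NumberTheory.Sieve
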